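import Literature.NumberTheory.Transcendental.PhilipponCriterionStepBounds
import Literature.NumberTheory.Transcendental.PhilipponCriterionDescend
import HarnessLib

/-!
# Philippon's criterion over Nesterenko's toolkit, XVI: rank one — proofs only

`Literature/NumberTheory/Transcendental/PhilipponCriterionRankOne.lean` — proofs only (no new
definitions, nothing asserted). Tools for the last part of Philippon's proof of Théorème 2.11
(Publ. Math. IHÉS 64 (1986), §3, Lemme 2.15 and "Fin de la démonstration", pp. 46–48), where the
primes `𝔓_{N,1}` of `(A_1)` have rank `1` (dimension `0`):

* `le_coneIdeal_of_mem_projZeros`, `one_le_ringKrullDim_quotient_coneIdeal`,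
  `exists_nat_ringKrullDim_quotient`, `eq_coneIdeal_of_rank_one`, `eq_of_rank_one` — a homogeneous
  prime of rank `1` through an affine point `(1 : z)` is the cone ideal of that point; two such
  primes through the same point coincide;
* `isHomogeneous_of_mem_minimalPrimes` — minimal primes of homogeneous ideals are homogeneous;
* `Setup.mem_of_bezoutDelta_le`, `Setup.mem_of_rho_lt` — the case `r = 1` of Prop. 4.11 / Cor. 4.12
  read contrapositively: a generator `E` with `δ e^{2Y} ≤ 1`-type smallness must lie in `𝔓`
  (Philippon: "l'inégalité (I) [resp. (II)] est intenable et donc …`ʰQ ∈ 𝔓`", pp. 46–47);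
* `Setup.mem_level_of_good` — at a level `N` where `(A_1)` holds, every generator `E N j ∈ 𝔓_{N,1}`;
* `Setup.bounds_of_descent` — (the rôle of Prop. 2.6, p. 47) if all `E L j ∈ 𝔓` and `V(𝔓)` has an
  affine point in the open polydisc of level `L`, then `𝔓` satisfies `(i)` at level `L`:
  `deg 𝔓 ≤ D₀ δ(L)^{r₀−1}`, `h(𝔓) ≤ B_1 τ(L) δ(L)^{r₀−1}/δ(L)` (`descent_to_point`).

## References

* [Philippon1986Criteres] P. Philippon, Publ. Math. IHÉS 64 (1986), §3, pp. 46–48.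
* [NesterenkoPhilippon2001] LNM 1752 (2001), Ch. 3 Prop. 4.11, Cor. 4.12 (case `r = 1`), pp. 40–41.
-/

noncomputable section

open MvPolynomial Real
open Literature.NumberTheory.Transcendental.Nesterenko

attribute [local instance] MvPolynomial.gradedAlgebra

namespace Literature.NumberTheory.Transcendental

namespace PhilipponMain

variable {m : ℕ}

/-! ### Rank-one primes through a point -/

/-- A homogeneous ideal vanishing at `y` lies in the cone ideal `𝔭_ȳ`. [folklore] -/
theorem le_coneIdeal_of_mem_projZeros {𝔓 : Ideal (Rx m)}
    (h𝔓c : ∀ g ∈ 𝔓, ∀ k : ℕ, homogeneousComponent k g ∈ 𝔓) {y : Fin (m + 1) → ℂ}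
    (hy : y ∈ projZeros 𝔓) : 𝔓 ≤ coneIdeal y := fun P hP =>
  (mem_coneIdeal_iff y P).mpr fun k => hy.2 _ (h𝔓c P hP k)

/-- `dim ℚ[x̲]/𝔭_ȳ ≥ 1` for an affine point `ȳ = (1 : z)`: `𝔭_ȳ ⊊ ker (P ↦ P(ȳ))` (the latter
contains `x₀ − 1`). [folklore] -/
theorem one_le_ringKrullDim_quotient_coneIdeal (z : Fin m → ℂ) :
    (1 : WithBot ℕ∞) ≤ ringKrullDim (Rx m ⧸ coneIdeal (Fin.cons 1 z : Fin (m + 1) → ℂ)) := by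
  set y : Fin (m + 1) → ℂ := Fin.cons 1 z with hy
  have hy0 : y ≠ 0 := cons_one_ne_zero z
  set 𝔪 : Ideal (Rx m) := RingHom.ker (aeval y : Rx m →ₐ[ℚ] ℂ) with h𝔪
  have h𝔪p : 𝔪.IsPrime := RingHom.ker_isPrime _
  have hle : coneIdeal y ≤ 𝔪 := fun P hP => by
    rw [h𝔪, RingHom.mem_ker]
    exact (mem_projZeros_coneIdeal hy0).2 P hP
  have hlt : coneIdeal y < 𝔪 := by
    refine lt_of_le_of_ne hle fun h => ?_
    have h1 : (X 0 - 1 : Rx m) ∈ 𝔪 := by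
      rw [h𝔪, RingHom.mem_ker]
      simp [hy]
    rw [← h, mem_coneIdeal_iff] at h1
    have h2 := h1 0
    rw [homogeneousComponent_zero] at h2
    simp at h2
  have h := ringKrullDim_quotient_add_one_le_of_lt (isPrime_coneIdeal y) hlt
  haveI : Nontrivial (Rx m ⧸ 𝔪) := Ideal.Quotient.nontrivial_iff.mpr h𝔪p.ne_top
  have h0 : (0 : WithBot ℕ∞) ≤ ringKrullDim (Rx m ⧸ 𝔪) := ringKrullDim_nonneg_of_nontrivial
  calc (1 : WithBot ℕ∞) = 0 + 1 := (zero_add 1).symm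
    _ ≤ ringKrullDim (Rx m ⧸ 𝔪) + 1 := add_le_add h0 le_rfl
    _ ≤ _ := h

/-- The Krull dimension of `ℚ[x̲]/𝔮`, `𝔮` prime, is a natural number. [folklore] -/
theorem exists_nat_ringKrullDim_quotient {𝔮 : Ideal (Rx m)} (h𝔮 : 𝔮.IsPrime) :
    ∃ r : ℕ, ringKrullDim (Rx m ⧸ 𝔮) = r := by
  haveI : IsDomain (Rx m ⧸ 𝔮) := Ideal.Quotient.isDomain 𝔮
  haveI : Algebra.FiniteType ℚ (Rx m ⧸ 𝔮) :=
    Algebra.FiniteType.of_surjective (Ideal.Quotient.mkₐ ℚ 𝔮) (Ideal.Quotient.mkₐ_surjective ℚ 𝔮)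
  exact ⟨_, Literature.RingTheory.KrullDimension.ringKrullDim_eq_trdeg ℚ (Rx m ⧸ 𝔮)⟩

/-- **A homogeneous prime of rank `1` through an affine point is the cone ideal of the point.**
[folklore] -/
theorem eq_coneIdeal_of_rank_one {𝔓 : Ideal (Rx m)} (h𝔓 : 𝔓.IsPrime)
    (h𝔓c : ∀ g ∈ 𝔓, ∀ k : ℕ, homogeneousComponent k g ∈ 𝔓) (h1 : IsUnmixedOfRank 𝔓 1)
    {z : Fin m → ℂ} (hz : (Fin.cons 1 z : Fin (m + 1) → ℂ) ∈ projZeros 𝔓) :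
    𝔓 = coneIdeal (Fin.cons 1 z : Fin (m + 1) → ℂ) := by
  have hle := le_coneIdeal_of_mem_projZeros h𝔓c hz
  have hP : ringKrullDim (Rx m ⧸ 𝔓) = (1 : ℕ) := ringKrullDim_quotient_eq_of_isUnmixedOfRank h𝔓 h1
  have hC : ringKrullDim (Rx m ⧸ coneIdeal (Fin.cons 1 z : Fin (m + 1) → ℂ)) = (1 : ℕ) := by
    refine le_antisymm ?_ (by exact_mod_cast one_le_ringKrullDim_quotient_coneIdeal z)
    rw [← hP]
    exact ringKrullDim_le_of_surjective _ (Ideal.Quotient.factor_surjective hle)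
  exact eq_of_le_of_ringKrullDim_quotient_eq h𝔓 hle hP hC

/-- Two homogeneous primes of rank `1` through the same affine point coincide. [folklore] -/
theorem eq_of_rank_one {𝔓 𝔔 : Ideal (Rx m)} (h𝔓 : 𝔓.IsPrime)
    (h𝔓c : ∀ g ∈ 𝔓, ∀ k : ℕ, homogeneousComponent k g ∈ 𝔓) (h𝔓1 : IsUnmixedOfRank 𝔓 1)
    (h𝔔 : 𝔔.IsPrime) (h𝔔c : ∀ g ∈ 𝔔, ∀ k : ℕ, homogeneousComponent k g ∈ 𝔔)
    (h𝔔1 : IsUnmixedOfRank 𝔔 1) {z : Fin m → ℂ}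
    (hz𝔓 : (Fin.cons 1 z : Fin (m + 1) → ℂ) ∈ projZeros 𝔓)
    (hz𝔔 : (Fin.cons 1 z : Fin (m + 1) → ℂ) ∈ projZeros 𝔔) : 𝔓 = 𝔔 :=
  (eq_coneIdeal_of_rank_one h𝔓 h𝔓c h𝔓1 hz𝔓).trans (eq_coneIdeal_of_rank_one h𝔔 h𝔔c h𝔔1 hz𝔔).symm

/-- Minimal primes of a homogeneous ideal are homogeneous (the homogeneous core of a prime is
prime). [folklore] -/
theorem isHomogeneous_of_mem_minimalPrimes {𝔄 𝔮 : Ideal (Rx m)}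
    (h𝔄 : 𝔄.IsHomogeneous (homogeneousSubmodule (Fin (m + 1)) ℚ)) (h𝔮 : 𝔮 ∈ 𝔄.minimalPrimes) :
    𝔮.IsHomogeneous (homogeneousSubmodule (Fin (m + 1)) ℚ) := by
  set 𝒜 := homogeneousSubmodule (Fin (m + 1)) ℚ
  have hcore : (𝔮.homogeneousCore 𝒜).toIdeal = 𝔮 := by
    refine le_antisymm (Ideal.toIdeal_homogeneousCore_le 𝒜 𝔮) ?_
    refine h𝔮.2 ⟨h𝔮.1.1.homogeneousCore, ?_⟩ (Ideal.toIdeal_homogeneousCore_le 𝒜 𝔮)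
    rw [← h𝔄.toIdeal_homogeneousCore_eq_self]
    exact Ideal.homogeneousCore_mono 𝒜 h𝔮.1.2
  rw [← hcore]
  exact (𝔮.homogeneousCore 𝒜).isHomogeneous

namespace Setup

variable (𝒮 : Setup)

/-! ### The case `r = 1` of Prop. 4.11 and Cor. 4.12, contrapositively -/

/-- **Prop. 4.11, `r = 1`**: for a generator `E = E L j` of a level `L ≥ N₀` (so that `deg E ≥ 1`
unless `E = 0`, `one_le_d`), if `h(E) deg 𝔓 + h(𝔓) dE + 11 m² deg 𝔓 dE ≤ Y` (`Y > 0`) and the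
quantity `δ` of Prop. 4.11 3) is `≤ e^{−2Y}`, then `E ∈ 𝔓` (otherwise `1 ≤ δ e^{Y'} ≤ e^{−Y} < 1`).
[cite: NesterenkoPhilippon2001, Ch. 3 Prop. 4.11 (r = 1) (p. 41)]
[cite: Philippon1986Criteres, §3 p. 46 ("l'inégalité (I) est intenable")] -/
theorem mem_of_bezoutDelta_le (h411 : NesterenkoPhilippon2001_ch3_prop_4_11) {𝔓 : Ideal (Rx 𝒮.m)}
    (h𝔓 : 𝔓.IsPrime) (h𝔓hom : 𝔓.IsHomogeneous (homogeneousSubmodule (Fin (𝒮.m + 1)) ℚ))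
    (h𝔓unm : IsUnmixedOfRank 𝔓 1) {L : ℕ} (hL : 𝒮.N₀ ≤ L) (j : Fin (𝒮.M L)) {Y : ℝ} (hY : 0 < Y)
    (hX : height (𝒮.E L j) * ideg 𝔓 1 + iheight 𝔓 1 * 𝒮.d L j +
      11 * (𝒮.m : ℝ) ^ 2 * ideg 𝔓 1 * 𝒮.d L j ≤ Y)
    (hδ : bezoutDelta 𝔓 1 (𝒮.E L j) 𝒮.ω ≤ exp (-(2 * Y))) : 𝒮.E L j ∈ 𝔓 := by
  by_contra hE
  have hE0 : 𝒮.E L j ≠ 0 := fun h => hE (h ▸ 𝔓.zero_mem)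
  have h := (h411 𝒮.m 1 𝔓 (𝒮.E L j) (𝒮.d L j) le_rfl 𝒮.one_le_m h𝔓 h𝔓hom h𝔓unm
    (𝒮.isHomogeneous_E L j) (𝒮.one_le_d hL j hE0) hE).2 rfl 𝒮.ω 𝒮.ω_ne_zero
  have h1 : bezoutDelta 𝔓 1 (𝒮.E L j) 𝒮.ω *
      exp (height (𝒮.E L j) * ideg 𝔓 1 + iheight 𝔓 1 * 𝒮.d L j +
        11 * (𝒮.m : ℝ) ^ 2 * ideg 𝔓 1 * 𝒮.d L j) ≤ exp (-(2 * Y)) * exp Y :=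
    mul_le_mul hδ (exp_le_exp.mpr hX) (exp_pos _).le (exp_pos _).le
  rw [← exp_add] at h1
  have h2 : exp (-(2 * Y) + Y) < 1 := exp_lt_one_iff.mpr (by linarith) |>.trans_le le_rfl
  linarith

/-- **Cor. 4.12, `r = 1`** (second case of Philippon's argument, p. 47): for a generator
`E = E M' j` of level `N₀ ≤ M' ≤ N` with `κ e^{−R(M'+1)} ≤ ρ_ω̄(𝔓)`, `|𝔓(ω̄)| ≤ e^{−A}` (`A > 0`)
and `5 ξ(N) (h(𝔓) dE + h(E) deg 𝔓 + 12 m² dE deg 𝔓) ≤ A/2`, one has `E ∈ 𝔓` (with the integer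
`η = ⌈4ξ(M')⌉`, otherwise `E ≠ 0`, `deg E ≥ 1` by `one_le_d`, and
`1 ≤ exp(−A + η(…)) ≤ e^{−A/2} < 1`).
[cite: NesterenkoPhilippon2001, Ch. 3 Cor. 4.12 (r = 1) (p. 41)]
[cite: Philippon1986Criteres, §3 p. 47 ("l'inégalité (II) est intenable")] -/
theorem mem_of_rho_lt (h412 : NesterenkoPhilippon2001_ch3_cor_4_12) {𝔓 : Ideal (Rx 𝒮.m)}
    (h𝔓 : 𝔓.IsPrime) (h𝔓hom : 𝔓.IsHomogeneous (homogeneousSubmodule (Fin (𝒮.m + 1)) ℚ))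
    (h𝔓unm : IsUnmixedOfRank 𝔓 1) {M' N : ℕ} (hM'0 : 𝒮.N₀ ≤ M') (hM'N : M' ≤ N)
    (j : Fin (𝒮.M M')) {A : ℝ} (hA : 0 < A) (hiabs : iabs 𝔓 1 𝒮.ω ≤ exp (-A))
    (hρge : 𝒮.κ * exp (-𝒮.R (M' + 1)) ≤ rho 𝒮.ω 𝔓) (hCb : 2 * (𝒮.m : ℝ) ≤ 𝒮.C)
    (hCc : log (4 * 𝒮.Θ ^ 2) ≤ 𝒮.C)
    (hY : 5 * 𝒮.ξ N * (iheight 𝔓 1 * 𝒮.d M' j + height (𝒮.E M' j) * ideg 𝔓 1 +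
      12 * (𝒮.m : ℝ) ^ 2 * 𝒮.d M' j * ideg 𝔓 1) ≤ A / 2) : 𝒮.E M' j ∈ 𝔓 := by
  by_contra hE
  have hE0 : 𝒮.E M' j ≠ 0 := fun h => hE (h ▸ 𝔓.zero_mem)
  have hnorm := 𝒮.normAt_le_exp_deg hM'0 j hCb
  have hpow : normAt 𝒮.ω (𝒮.E M' j) ^ ⌈4 * 𝒮.ξ M'⌉₊ ≤ max (exp (-A)) (rho 𝒮.ω 𝔓) ^ 2 :=
    (𝒮.normAt_pow_eta_le_sq hM'0 j hρge hCc).trans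
      (pow_le_pow_left₀ (rho_nonneg _ _) (le_max_right _ _) 2)
  have h := (h412 𝒮.m 1 𝔓 (𝒮.E M' j) (𝒮.d M' j) le_rfl 𝒮.one_le_m h𝔓 h𝔓hom h𝔓unm hE0
    (𝒮.isHomogeneous_E M' j) (𝒮.one_le_d hM'0 j hE0) hE 𝒮.ω A ⌈4 * 𝒮.ξ M'⌉₊ 𝒮.ω_ne_zero hA
    (𝒮.eta_pos M') hiabs hnorm hpow).2 rfl
  have hηle : (⌈4 * 𝒮.ξ M'⌉₊ : ℝ) ≤ 5 * 𝒮.ξ N := 𝒮.eta_le hM'N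
  have hpos : 0 ≤ iheight 𝔓 1 * (𝒮.d M' j : ℝ) + height (𝒮.E M' j) * ideg 𝔓 1 +
      12 * (𝒮.m : ℝ) ^ 2 * 𝒮.d M' j * ideg 𝔓 1 := by
    have := mul_nonneg (height_nonneg (chowForm 𝔓 1)) (Nat.cast_nonneg (𝒮.d M' j) : (0 : ℝ) ≤ _)
    have := mul_nonneg (height_nonneg (𝒮.E M' j)) (Nat.cast_nonneg (ideg 𝔓 1) : (0 : ℝ) ≤ _)
    have : (0 : ℝ) ≤ 12 * (𝒮.m : ℝ) ^ 2 * 𝒮.d M' j * ideg 𝔓 1 := by positivity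
    unfold iheight
    linarith
  have h1 : (⌈4 * 𝒮.ξ M'⌉₊ : ℝ) * (iheight 𝔓 1 * 𝒮.d M' j + height (𝒮.E M' j) * ideg 𝔓 1 +
      12 * (𝒮.m : ℝ) ^ 2 * 𝒮.d M' j * ideg 𝔓 1) ≤ A / 2 :=
    (mul_le_mul_of_nonneg_right hηle hpos).trans hY
  have h2 : exp (-A + ⌈4 * 𝒮.ξ M'⌉₊ * (iheight 𝔓 1 * 𝒮.d M' j + height (𝒮.E M' j) * ideg 𝔓 1 +
      12 * (𝒮.m : ℝ) ^ 2 * 𝒮.d M' j * ideg 𝔓 1)) < 1 := exp_lt_one_iff.mpr (by linarith)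
  linarith

/-! ### At a level where `(A_1)` holds, all generators lie in `𝔓` -/

/-- **All generators of level `N` lie in `𝔓_{N,1}`** (Philippon 1986, p. 46: "`N` vérifie les
conditions (*) et (**)"): if `𝔓` satisfies `(A_1)` at level `N` with `Λ_1(N) ≥ 2(1+11m²)` and
`C ≥ 2(1+11m²)(B_1 + D₀)`, then `E N j ∈ 𝔓` for every `j` (Prop. 4.11 with `r = 1`, both cases
of `δ ≤ max(e^{−S(N)}, e^{−Λ_1 size})`). [cite: Philippon1986Criteres, §3 Lemme 2.15 (p. 46)] -/
theorem mem_level_of_good (h44 : NesterenkoPhilippon2001_ch3_prop_4_4)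
    (h411 : NesterenkoPhilippon2001_ch3_prop_4_11) {lam : ℝ} {N : ℕ} (hN : 𝒮.N₀ ≤ N)
    {𝔓 : Ideal (Rx 𝒮.m)} (hgood : 𝒮.Good lam N 1 𝔓)
    (hΛb : 2 * (1 + 11 * (𝒮.m : ℝ) ^ 2) ≤ 𝒮.Λ lam 1 N)
    (hCa : 2 * (1 + 11 * (𝒮.m : ℝ) ^ 2) * (𝒮.B 1 + 𝒮.D₀) ≤ 𝒮.C) (j : Fin (𝒮.M N)) :
    𝒮.E N j ∈ 𝔓 := by
  obtain ⟨h𝔓, h𝔓hom, -, r', hr'1, hr'r, hunm, hdeg, hh, hsmall⟩ := hgood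
  obtain rfl : r' = 1 := le_antisymm hr'r hr'1
  have hdeg1 : 1 ≤ ideg 𝔓 1 :=
    Literature.Barriers.Schanuel.one_le_ideg_of_isPrime h44 le_rfl 𝒮.one_le_m h𝔓 h𝔓hom hunm
  set s := 𝒮.size N 𝔓 1 with hs
  have hs1 : 1 ≤ s := by
    have h1 : (1 : ℝ) ≤ 𝒮.τ N * ideg 𝔓 1 :=
      one_le_mul_of_one_le_of_one_le (𝒮.one_le_τ N) (by exact_mod_cast hdeg1)
    exact h1.trans (𝒮.τ_mul_ideg_le_size N 𝔓 1)
  have hm : (0 : ℝ) ≤ 11 * (𝒮.m : ℝ) ^ 2 := by positivity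
  refine 𝒮.mem_of_bezoutDelta_le h411 h𝔓 h𝔓hom hunm hN j (Y := (1 + 11 * (𝒮.m : ℝ) ^ 2) * s)
    (by positivity) (𝒮.bezout_exponent_le le_rfl hN j 𝔓 1) ?_
  -- `δ ≤ max(‖E‖, |𝔓|) ≤ max(e^{−S(N)}, e^{−Λ s}) ≤ e^{−2(1+11m²)s}`
  have hcS := 𝒮.cS_mul_size_le_half_S le_rfl N hdeg hh hCa
  refine (bezoutDelta_le_max 𝔓 1 (𝒮.E N j) 𝒮.ω).trans (max_le ?_ ?_)
  · refine (𝒮.normAt_le N hN j).trans (exp_le_exp.mpr ?_)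
    change (1 + 11 * (𝒮.m : ℝ) ^ 2) * s ≤ 𝒮.S N / 2 at hcS
    linarith
  · refine hsmall.trans (exp_le_exp.mpr (neg_le_neg ?_))
    have hs0 : 0 ≤ s := by linarith
    nlinarith [mul_le_mul_of_nonneg_right hΛb hs0]

/-! ### Bounds at a level through the descent -/

/-- The height bookkeeping of the descent at level `L`:
`H₀ δ^{r₀−1} + (r₀−1)(σ + (m(r₀+1)+m²)δ) D' δ^{r₀−1}/δ ≤ B_1 τ δ^{r₀−1}/δ` for `D' ≤ D₀`.
[folklore] -/
theorem descent_height_le (L : ℕ) {h D' : ℝ} (hD' : D' ≤ 𝒮.D₀) (hD'0 : 0 ≤ D')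
    (hh : h ≤ 𝒮.H₀ * 𝒮.δ L ^ (𝒮.r₀ - 1) + ((𝒮.r₀ - 1 : ℕ) : ℝ) *
      (𝒮.σ L + ((𝒮.m : ℝ) * (𝒮.r₀ + 1) + (𝒮.m : ℝ) ^ 2) * 𝒮.δ L) * D' * 𝒮.δ L ^ (𝒮.r₀ - 1) / 𝒮.δ L) :
    h ≤ 𝒮.B 1 * 𝒮.τ L * 𝒮.δ L ^ (𝒮.r₀ - 1) / 𝒮.δ L := by
  have hδ := 𝒮.δ_pos L
  have hτ := 𝒮.τ_pos L
  have hδτ := 𝒮.δ_le_τ L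
  have hστ := 𝒮.σ_le_τ L
  have hH := 𝒮.H₀_nonneg
  have hm0 : (0 : ℝ) ≤ 𝒮.m := Nat.cast_nonneg _
  have hj0 : (0 : ℝ) ≤ ((𝒮.r₀ - 1 : ℕ) : ℝ) := Nat.cast_nonneg _
  set P : ℝ := 𝒮.δ L ^ (𝒮.r₀ - 1) with hP
  have hP0 : 0 < P := by positivity
  refine hh.trans ?_
  rw [le_div_iff₀ hδ, add_mul, div_mul_cancel₀ _ hδ.ne']
  have hB : 𝒮.B 1 = 𝒮.H₀ + ((𝒮.r₀ - 1 : ℕ) : ℝ) * 𝒮.D₀ * 𝒮.cB := rfl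
  have hcB : 𝒮.cB = 1 + (𝒮.m : ℝ) * (𝒮.k + 2) + (𝒮.m : ℝ) ^ 2 := rfl
  have hr : (𝒮.r₀ : ℝ) + 1 ≤ 𝒮.k + 2 := by
    have := 𝒮.r₀_le
    have : (𝒮.r₀ : ℝ) ≤ 𝒮.k + 1 := by exact_mod_cast this
    linarith
  -- first term: `H₀ P δ ≤ H₀ τ P`
  have t1 : 𝒮.H₀ * P * 𝒮.δ L ≤ 𝒮.H₀ * 𝒮.τ L * P := by
    have := mul_le_mul_of_nonneg_left hδτ (mul_nonneg hH hP0.le)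
    nlinarith
  -- second term: `(σ + (m(r₀+1)+m²)δ) D' ≤ c_B τ D₀`
  have t2a : 𝒮.σ L + ((𝒮.m : ℝ) * (𝒮.r₀ + 1) + (𝒮.m : ℝ) ^ 2) * 𝒮.δ L ≤ 𝒮.cB * 𝒮.τ L := by
    rw [hcB]
    have e1 : ((𝒮.m : ℝ) * (𝒮.r₀ + 1) + (𝒮.m : ℝ) ^ 2) ≤ (𝒮.m : ℝ) * (𝒮.k + 2) + (𝒮.m : ℝ) ^ 2 := by
      nlinarith [mul_le_mul_of_nonneg_left hr hm0]
    have e2 : ((𝒮.m : ℝ) * (𝒮.r₀ + 1) + (𝒮.m : ℝ) ^ 2) * 𝒮.δ L ≤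
        ((𝒮.m : ℝ) * (𝒮.k + 2) + (𝒮.m : ℝ) ^ 2) * 𝒮.τ L :=
      mul_le_mul e1 hδτ hδ.le (by positivity)
    nlinarith
  have t2 : ((𝒮.r₀ - 1 : ℕ) : ℝ) * (𝒮.σ L + ((𝒮.m : ℝ) * (𝒮.r₀ + 1) + (𝒮.m : ℝ) ^ 2) * 𝒮.δ L) *
      D' * P ≤ ((𝒮.r₀ - 1 : ℕ) : ℝ) * (𝒮.cB * 𝒮.τ L) * 𝒮.D₀ * P := by
    have hσpos : 0 ≤ 𝒮.σ L + ((𝒮.m : ℝ) * (𝒮.r₀ + 1) + (𝒮.m : ℝ) ^ 2) * 𝒮.δ L := by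
      have := 𝒮.one_le_σ L; positivity
    apply mul_le_mul_of_nonneg_right _ hP0.le
    apply mul_le_mul (mul_le_mul_of_nonneg_left t2a hj0) hD' hD'0 (by
      have := 𝒮.one_le_cB; positivity)
  rw [hB]
  nlinarith

/-- **Bounds through the descent** (Philippon 1986, p. 47, via Prop. 2.6): let `𝔓 ⊇ 𝔓₀` be a
homogeneous prime of rank `1`, `L ≥ N₀` a level with `E L j ∈ 𝔓` for all `j`, and `(1 : z) ∈ V(𝔓)`
with `max |z_i − θ_i| < e^{−R(L)}`. Then `deg 𝔓 ≤ D₀ δ(L)^{r₀−1}` and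
`h(𝔓) ≤ B_1 τ(L) δ(L)^{r₀−1}/δ(L)` (descend from `𝔓₀` along the component through `(1 : z)` with
the generators of level `L`; at rank `1` the prime through `(1 : z)` is `𝔓`).
[cite: Philippon1986Criteres, §3 Lemme 2.15 (p. 47) and Prop. 2.6] -/
theorem bounds_of_descent (h47 : NesterenkoPhilippon2001_ch3_prop_4_7)
    (h411 : NesterenkoPhilippon2001_ch3_prop_4_11) (hr₀m : 𝒮.r₀ ≤ 𝒮.m) {𝔓 : Ideal (Rx 𝒮.m)}
    (h𝔓 : 𝔓.IsPrime) (h𝔓hom : 𝔓.IsHomogeneous (homogeneousSubmodule (Fin (𝒮.m + 1)) ℚ))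
    (h𝔓unm : IsUnmixedOfRank 𝔓 1) (h0 : 𝒮.𝔓₀ ≤ 𝔓) {L : ℕ} (hL : 𝒮.N₀ ≤ L)
    (hb : ∀ j, 𝒮.E L j ∈ 𝔓) {z : Fin 𝒮.m → ℂ}
    (hz : (Fin.cons 1 z : Fin (𝒮.m + 1) → ℂ) ∈ projZeros 𝔓) (hzθ : ∀ i, ‖z i - 𝒮.θ i‖ < exp (-𝒮.R L)) :
    (ideg 𝔓 1 : ℝ) ≤ 𝒮.D₀ * 𝒮.δ L ^ (𝒮.r₀ - 1) ∧
      iheight 𝔓 1 ≤ 𝒮.B 1 * 𝒮.τ L * 𝒮.δ L ^ (𝒮.r₀ - 1) / 𝒮.δ L := by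
  have hr₀1 := 𝒮.one_le_r₀
  have hz0 : (Fin.cons 1 z : Fin (𝒮.m + 1) → ℂ) ∈ projZeros 𝒮.𝔓₀ := projZeros_antitone h0 hz
  have hzE : ∀ j, aeval (Fin.cons 1 z : Fin (𝒮.m + 1) → ℂ) (𝒮.E L j) = 0 := fun j => hz.2 _ (hb j)
  obtain ⟨𝔔, h𝔔, h𝔔hom, h𝔔unm, -, hz𝔔, hdeg, hh⟩ := descent_to_point h47 h411 hr₀1 hr₀m
    𝒮.isPrime_𝔓₀ 𝒮.isHomogeneous_𝔓₀ 𝒮.rank_𝔓₀ 𝒮.θ (exp_pos (-𝒮.R L)) (𝒮.E L) (𝒮.d L)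
    (𝒮.isHomogeneous_E L) (𝒮.one_le_δ L) (le_trans zero_le_one (𝒮.one_le_σ L)) (𝒮.d_le L hL)
    (𝒮.height_le L hL) (𝒮.finite_zeros L hL) hz0 hzθ hzE (𝒮.r₀ - 1) (by omega)
  have e : 𝒮.r₀ - (𝒮.r₀ - 1) = 1 := by omega
  rw [e] at h𝔔unm hdeg hh
  -- `𝔔 = 𝔓`
  have h𝔔𝔓 : 𝔔 = 𝔓 := eq_of_rank_one h𝔔 (fun g hg k => homogeneousComponent_mem_of_mem h𝔔hom hg k)
    h𝔔unm h𝔓 (fun g hg k => homogeneousComponent_mem_of_mem h𝔓hom hg k) h𝔓unm hz𝔔 hz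
  subst h𝔔𝔓
  have hD' : (ideg 𝒮.𝔓₀ 𝒮.r₀ : ℝ) ≤ 𝒮.D₀ := by exact_mod_cast 𝒮.ideg_𝔓₀_le_D₀
  refine ⟨hdeg.trans (mul_le_mul_of_nonneg_right hD' (by have := 𝒮.δ_pos L; positivity)),
    𝒮.descent_height_le L hD' (Nat.cast_nonneg _) ?_⟩
  have e2 : iheight 𝒮.𝔓₀ 𝒮.r₀ = 𝒮.H₀ := rfl
  rw [e2] at hh
  convert hh using 2

end Setup

end PhilipponMain

end Literature.NumberTheory.Transcendental

end
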